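import Summits.QuantumFields.YangMills.Theorems.AllWindowsColdBoxBoxHighLineTiltNormTransferGauss

/-!
# T-S5.13K (abstract layer) «TiltCumulantBounds» — the third/fourth tilted cumulants in terms of constant-centred moments

Continuation of ✓`…TiltNormTransfer` / ✓`…TiltNormTransferGauss` (T-S5.13n) towards planner ym-idea-2 g18's T-S5.13K «cumulant sizes on D»
(ASSEMBLY-S5 §6 (e4)/(e5)): the two joint cumulants along the exponential tilt are reduced, BY NAME and with absolute constants, to
CONSTANT-CENTRED second/fourth moments — the quantities the Gaussian-size bricks (✓12b/12c/12d/12e, ✓H) control after the restriction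
`D → ℝ^{3|E|}` (✓13r/✓6g):

* `Tilt.abs_tiltExp_mul_mul_le` — the `L⁴·L⁴·L²` Hölder bound `|E_t[XYZ]| ≤ (E_tX⁴)^{1/4}(E_tY⁴)^{1/4}(E_tZ²)^{1/2}` (two Cauchy–Schwarz steps), the
  shape of (e4) even×even;
* ★ `Tilt.abs_tiltCum4_le_of_moments` — if `E_t[(G₁−a₁)²] ≤ m₁`, `E_t[(G₂−a₂)²] ≤ m₂`, `E_t[(U−b)²] ≤ mU`, `E_t[(Gᵢ−aᵢ)²(U−b)²] ≤ pᵢ` then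
  `|κ₄,t(G₁,G₂,U,U)| ≤ √(4p₁ + 12m₁mU)·√(4p₂ + 12m₂mU) + 3·√m₁·√m₂·mU` (✓n4 `abs_tiltCum4_le` + ✓n4 re-centring + ✓n2 variance minimality);
* ★ `Tilt.abs_tiltCum4_muD_le` — the same over `μ_D = 1_{smallField s}·e^{−β·boxQuadForm}` with every moment replaced by
  `e^{2tB}·R(Y)`, `R(Y) := gaussAvg β H (sfInd·Y)/gaussAvg β H (sfInd)`, `B = sup_D |U|` (✓n5 `tiltExp_muD_le_gaussAvg`).

Tree + Mathlib; no definitions.  HONEST LABEL: abstract plumbing for T-S5.13 of the XL stub S5 (LINE-19 ⟨stmt-QuantumFields-24004⟩/⟨24335⟩) on a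
critic-PASSed DRAFT line; 13K's concrete sizes, 13, S5, U5, ⟨24004⟩ ⟨24335⟩ ⟨24336⟩ remain OPEN; **the Yang–Mills mass gap is NOT proved by this file;
no summit is proved by a line.**  Seat ym-line-sfw-p2-w5 g22 (EXTRA WIDTH seat w5, cell ym-idea-1).
-/

set_option autoImplicit false

noncomputable section

open MeasureTheory Set
open Summit.QuantumFields.YangMills.Cruxes.NT.SkewResponse

namespace Summit.QuantumFields.YangMills.Theorems.AllWindowsColdBoxBoxHighLine

namespace Tilt

variable {Ω : Type*} [MeasurableSpace Ω] {μ : Measure Ω}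

/-! ## The `L⁴·L⁴·L²` Hölder bound -/

/-- **`|E_t[XYZ]| ≤ (E_tX⁴)^{1/4}·(E_tY⁴)^{1/4}·(E_tZ²)^{1/2}`**, written with square roots: `≤ √(√E_tX⁴·√E_tY⁴)·√E_tZ²`
(bounded measurable `X, Y, Z`; `μ` finite). -/
theorem abs_tiltExp_mul_mul_le {X Y Z : Ω → ℝ} {BX BY BZ : ℝ} (hX : Measurable X) (hY : Measurable Y) (hZ : Measurable Z)
    (hXb : ∀ x, |X x| ≤ BX) (hYb : ∀ x, |Y x| ≤ BY) (hZb : ∀ x, |Z x| ≤ BZ) (U : Ω → ℝ) (t : ℝ) :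
    |tiltExp μ U t (fun x => X x * Y x * Z x)| ≤
      Real.sqrt (Real.sqrt (tiltExp μ U t (fun x => X x ^ 4)) * Real.sqrt (tiltExp μ U t (fun x => Y x ^ 4))) *
        Real.sqrt (tiltExp μ U t (fun x => Z x ^ 2)) := by
  have hXY : Measurable fun x => X x * Y x := hX.mul hY
  have hXYb : ∀ x, |X x * Y x| ≤ BX * BY := fun x => by
    rw [abs_mul]; exact mul_le_mul (hXb x) (hYb x) (abs_nonneg _) ((abs_nonneg _).trans (hXb x))
  have h1 := abs_tiltExp_mul_le (μ := μ) hXY hZ hXYb hZb U t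
  -- `E_t[(XY)²] ≤ √E_tX⁴ √E_tY⁴`
  have hX2 : Measurable fun x => X x ^ 2 := hX.pow_const 2
  have hY2 : Measurable fun x => Y x ^ 2 := hY.pow_const 2
  have hX2b : ∀ x, |X x ^ 2| ≤ BX ^ 2 := fun x => by rw [abs_pow]; exact pow_le_pow_left₀ (abs_nonneg _) (hXb x) 2
  have hY2b : ∀ x, |Y x ^ 2| ≤ BY ^ 2 := fun x => by rw [abs_pow]; exact pow_le_pow_left₀ (abs_nonneg _) (hYb x) 2
  have h2 := abs_tiltExp_mul_le (μ := μ) hX2 hY2 hX2b hY2b U t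
  have e1 : (fun x => (X x * Y x) ^ 2) = fun x => X x ^ 2 * Y x ^ 2 := by funext x; ring
  have e2 : (fun x => (X x ^ 2) ^ 2) = fun x => X x ^ 4 := by funext x; ring
  have e3 : (fun x => (Y x ^ 2) ^ 2) = fun x => Y x ^ 4 := by funext x; ring
  rw [e2, e3] at h2
  rw [e1] at h1
  have h2' : tiltExp μ U t (fun x => X x ^ 2 * Y x ^ 2) ≤
      Real.sqrt (tiltExp μ U t (fun x => X x ^ 4)) * Real.sqrt (tiltExp μ U t (fun x => Y x ^ 4)) :=
    (le_abs_self _).trans h2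
  calc |tiltExp μ U t (fun x => X x * Y x * Z x)|
      ≤ Real.sqrt (tiltExp μ U t (fun x => X x ^ 2 * Y x ^ 2)) * Real.sqrt (tiltExp μ U t (fun x => Z x ^ 2)) := h1
    _ ≤ Real.sqrt (Real.sqrt (tiltExp μ U t (fun x => X x ^ 4)) * Real.sqrt (tiltExp μ U t (fun x => Y x ^ 4))) *
        Real.sqrt (tiltExp μ U t (fun x => Z x ^ 2)) :=
        mul_le_mul_of_nonneg_right (Real.sqrt_le_sqrt h2') (Real.sqrt_nonneg _)

/-! ## The fourth cumulant from constant-centred moment bounds -/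

/-- ★ **`κ₄,t` from constant-centred moments**: if `E_t[(G₁−a₁)²] ≤ m₁`, `E_t[(G₂−a₂)²] ≤ m₂`, `E_t[(U−b)²] ≤ mU`,
`E_t[(G₁−a₁)²(U−b)²] ≤ p₁`, `E_t[(G₂−a₂)²(U−b)²] ≤ p₂`, then
`|κ₄,t(G₁,G₂,U,U)| ≤ √(4p₁ + 12·m₁·mU)·√(4p₂ + 12·m₂·mU) + 3·√m₁·√m₂·mU`. -/
theorem abs_tiltCum4_le_of_moments [IsFiniteMeasure μ] [NeZero μ] {U G₁ G₂ : Ω → ℝ} {BU B₁ B₂ : ℝ} (hU : Measurable U)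
    (h₁ : Measurable G₁) (h₂ : Measurable G₂) (hUb : ∀ x, |U x| ≤ BU) (h₁b : ∀ x, |G₁ x| ≤ B₁) (h₂b : ∀ x, |G₂ x| ≤ B₂)
    (t a₁ a₂ b : ℝ) {m₁ m₂ mU p₁ p₂ : ℝ}
    (hm₁ : tiltExp μ U t (fun x => (G₁ x - a₁) ^ 2) ≤ m₁) (hm₂ : tiltExp μ U t (fun x => (G₂ x - a₂) ^ 2) ≤ m₂)
    (hmU : tiltExp μ U t (fun x => (U x - b) ^ 2) ≤ mU)
    (hp₁ : tiltExp μ U t (fun x => (G₁ x - a₁) ^ 2 * (U x - b) ^ 2) ≤ p₁)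
    (hp₂ : tiltExp μ U t (fun x => (G₂ x - a₂) ^ 2 * (U x - b) ^ 2) ≤ p₂) :
    |tiltCum4 μ U t G₁ G₂| ≤
      Real.sqrt (4 * p₁ + 12 * (m₁ * mU)) * Real.sqrt (4 * p₂ + 12 * (m₂ * mU)) + 3 * (Real.sqrt m₁ * Real.sqrt m₂) * mU := by
  haveI := isProbabilityMeasure_tilted_mul (μ := μ) hU hUb t
  have hK := abs_tiltCum4_le (μ := μ) hU h₁ h₂ hUb h₁b h₂b t
  -- centred second moments are below the constant-centred ones (variance minimality)
  have hv₁ := (tiltExp_centredSq_le (μ := μ) hU h₁ hUb h₁b t a₁).trans hm₁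
  have hv₂ := (tiltExp_centredSq_le (μ := μ) hU h₂ hUb h₂b t a₂).trans hm₂
  have hvU := (tiltExp_centredSq_le (μ := μ) hU hU hUb hUb t b).trans hmU
  -- the mixed fourth moments by re-centring
  have hq₁ := (tiltExp_centredSq_mul_centredSq_le (μ := μ) hU h₁ hU hUb h₁b hUb t a₁ b).trans
    (show 4 * tiltExp μ U t (fun x => (G₁ x - a₁) ^ 2 * (U x - b) ^ 2) +
        12 * (tiltExp μ U t (fun x => (G₁ x - a₁) ^ 2) * tiltExp μ U t (fun x => (U x - b) ^ 2)) ≤ 4 * p₁ + 12 * (m₁ * mU) from by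
      have h0 : 0 ≤ tiltExp μ U t (fun x => (G₁ x - a₁) ^ 2) := by
        rw [tiltExp_eq_integral_tilted]; exact integral_nonneg fun x => sq_nonneg _
      have h0' : 0 ≤ tiltExp μ U t (fun x => (U x - b) ^ 2) := by
        rw [tiltExp_eq_integral_tilted]; exact integral_nonneg fun x => sq_nonneg _
      nlinarith [mul_le_mul hm₁ hmU h0' (h0.trans hm₁)])
  have hq₂ := (tiltExp_centredSq_mul_centredSq_le (μ := μ) hU h₂ hU hUb h₂b hUb t a₂ b).trans
    (show 4 * tiltExp μ U t (fun x => (G₂ x - a₂) ^ 2 * (U x - b) ^ 2) +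
        12 * (tiltExp μ U t (fun x => (G₂ x - a₂) ^ 2) * tiltExp μ U t (fun x => (U x - b) ^ 2)) ≤ 4 * p₂ + 12 * (m₂ * mU) from by
      have h0 : 0 ≤ tiltExp μ U t (fun x => (G₂ x - a₂) ^ 2) := by
        rw [tiltExp_eq_integral_tilted]; exact integral_nonneg fun x => sq_nonneg _
      have h0' : 0 ≤ tiltExp μ U t (fun x => (U x - b) ^ 2) := by
        rw [tiltExp_eq_integral_tilted]; exact integral_nonneg fun x => sq_nonneg _
      nlinarith [mul_le_mul hm₂ hmU h0' (h0.trans hm₂)])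
  -- nonnegativity of the centred moments
  have n₁ : 0 ≤ tiltExp μ U t (fun x => (G₁ x - tiltExp μ U t G₁) ^ 2) := by
    rw [tiltExp_eq_integral_tilted]; exact integral_nonneg fun x => sq_nonneg _
  have n₂ : 0 ≤ tiltExp μ U t (fun x => (G₂ x - tiltExp μ U t G₂) ^ 2) := by
    rw [tiltExp_eq_integral_tilted]; exact integral_nonneg fun x => sq_nonneg _
  have nU : 0 ≤ tiltExp μ U t (fun x => (U x - tiltExp μ U t U) ^ 2) := by
    rw [tiltExp_eq_integral_tilted]; exact integral_nonneg fun x => sq_nonneg _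
  -- monotonicity of the square roots
  have s₁ := Real.sqrt_le_sqrt hq₁
  have s₂ := Real.sqrt_le_sqrt hq₂
  have r₁ := Real.sqrt_le_sqrt hv₁
  have r₂ := Real.sqrt_le_sqrt hv₂
  refine hK.trans ?_
  gcongr

/-! ## Over `μ_D = 1_{smallField s}·e^{−β·boxQuadForm}`: every moment through `gaussAvg` letters -/

/-- A bounded measurable observable times `gaussWeight` is integrable (`β > 0`). -/
theorem integrable_bdd_mul_gaussWeight (H : ℕ) {β : ℝ} (hβ : 0 < β) {Y : (LandauFree H → E3) → ℝ} {C : ℝ} (hY : Measurable Y)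
    (hYb : ∀ a, |Y a| ≤ C) : Integrable fun a => Y a * gaussWeight β H a :=
  (EdgeChartGaussian.integrable_gaussWeight H hβ).bdd_mul hY.aestronglyMeasurable
    (Filter.Eventually.of_forall fun a => by rw [Real.norm_eq_abs]; exact hYb a)

/-- ★ **`κ₄,t` over `μ_D` through restricted Gaussian moments**: with `E = e^{2tB}` (`|U| ≤ B` on `smallField H s`, `0 ≤ t`) and
`R(Y) = gaussAvg β H (sfInd·Y)/gaussAvg β H (sfInd)`, for all constants `a₁, a₂, b`:
`|κ₄,t(G₁,G₂,U,U)| ≤ √(4E·R((G₁−a₁)²(U−b)²) + 12·E²·R((G₁−a₁)²)·R((U−b)²)) · √(same with G₂, a₂) + 3·√(E·R((G₁−a₁)²))·√(E·R((G₂−a₂)²))·E·R((U−b)²)`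
(globally bounded measurable `U, G₁, G₂` — e.g. the `D`-truncations the assembler tilts with). -/
theorem abs_tiltCum4_muD_le (H : ℕ) {β : ℝ} (hβ : 0 < β) {s : ℝ} (hD : 0 < ∫ a, sfInd H s a * gaussWeight β H a)
    {U G₁ G₂ : (LandauFree H → E3) → ℝ} {BU B₁ B₂ B : ℝ} (hU : Measurable U) (h₁ : Measurable G₁) (h₂ : Measurable G₂)
    (hUb : ∀ a, |U a| ≤ BU) (h₁b : ∀ a, |G₁ a| ≤ B₁) (h₂b : ∀ a, |G₂ a| ≤ B₂) (hUD : ∀ a ∈ smallField H s, |U a| ≤ B)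
    {t : ℝ} (ht : 0 ≤ t) (a₁ a₂ b : ℝ) :
    |tiltCum4 ((volume.restrict (smallField H s)).withDensity fun a => ENNReal.ofReal (gaussWeight β H a)) U t G₁ G₂| ≤
      Real.sqrt (4 * (Real.exp (2 * t * B) *
            (gaussAvg β H (fun a => sfInd H s a * ((G₁ a - a₁) ^ 2 * (U a - b) ^ 2)) / gaussAvg β H (sfInd H s))) +
          12 * ((Real.exp (2 * t * B) * (gaussAvg β H (fun a => sfInd H s a * (G₁ a - a₁) ^ 2) / gaussAvg β H (sfInd H s))) *
            (Real.exp (2 * t * B) * (gaussAvg β H (fun a => sfInd H s a * (U a - b) ^ 2) / gaussAvg β H (sfInd H s))))) *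
        Real.sqrt (4 * (Real.exp (2 * t * B) *
            (gaussAvg β H (fun a => sfInd H s a * ((G₂ a - a₂) ^ 2 * (U a - b) ^ 2)) / gaussAvg β H (sfInd H s))) +
          12 * ((Real.exp (2 * t * B) * (gaussAvg β H (fun a => sfInd H s a * (G₂ a - a₂) ^ 2) / gaussAvg β H (sfInd H s))) *
            (Real.exp (2 * t * B) * (gaussAvg β H (fun a => sfInd H s a * (U a - b) ^ 2) / gaussAvg β H (sfInd H s))))) +
      3 * (Real.sqrt (Real.exp (2 * t * B) * (gaussAvg β H (fun a => sfInd H s a * (G₁ a - a₁) ^ 2) / gaussAvg β H (sfInd H s))) *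
          Real.sqrt (Real.exp (2 * t * B) * (gaussAvg β H (fun a => sfInd H s a * (G₂ a - a₂) ^ 2) / gaussAvg β H (sfInd H s)))) *
        (Real.exp (2 * t * B) * (gaussAvg β H (fun a => sfInd H s a * (U a - b) ^ 2) / gaussAvg β H (sfInd H s))) := by
  haveI := isFiniteMeasure_muD H hβ s
  haveI := neZero_muD H hβ hD
  -- the five constant-centred observables: measurable, bounded, nonnegative
  have m₁ : Measurable fun a => (G₁ a - a₁) ^ 2 := (h₁.sub measurable_const).pow_const 2
  have m₂ : Measurable fun a => (G₂ a - a₂) ^ 2 := (h₂.sub measurable_const).pow_const 2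
  have mU : Measurable fun a => (U a - b) ^ 2 := (hU.sub measurable_const).pow_const 2
  have c₁ : ∀ a, |G₁ a - a₁| ≤ B₁ + |a₁| := fun a => (abs_sub _ _).trans (add_le_add (h₁b a) le_rfl)
  have c₂ : ∀ a, |G₂ a - a₂| ≤ B₂ + |a₂| := fun a => (abs_sub _ _).trans (add_le_add (h₂b a) le_rfl)
  have cU : ∀ a, |U a - b| ≤ BU + |b| := fun a => (abs_sub _ _).trans (add_le_add (hUb a) le_rfl)
  have b₁ : ∀ a, |(G₁ a - a₁) ^ 2| ≤ (B₁ + |a₁|) ^ 2 := fun a => by rw [abs_pow]; exact pow_le_pow_left₀ (abs_nonneg _) (c₁ a) 2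
  have b₂ : ∀ a, |(G₂ a - a₂) ^ 2| ≤ (B₂ + |a₂|) ^ 2 := fun a => by rw [abs_pow]; exact pow_le_pow_left₀ (abs_nonneg _) (c₂ a) 2
  have bU : ∀ a, |(U a - b) ^ 2| ≤ (BU + |b|) ^ 2 := fun a => by rw [abs_pow]; exact pow_le_pow_left₀ (abs_nonneg _) (cU a) 2
  have bp₁ : ∀ a, |(G₁ a - a₁) ^ 2 * (U a - b) ^ 2| ≤ (B₁ + |a₁|) ^ 2 * (BU + |b|) ^ 2 := fun a => by
    rw [abs_mul]; exact mul_le_mul (b₁ a) (bU a) (abs_nonneg _) ((abs_nonneg _).trans (b₁ a))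
  have bp₂ : ∀ a, |(G₂ a - a₂) ^ 2 * (U a - b) ^ 2| ≤ (B₂ + |a₂|) ^ 2 * (BU + |b|) ^ 2 := fun a => by
    rw [abs_mul]; exact mul_le_mul (b₂ a) (bU a) (abs_nonneg _) ((abs_nonneg _).trans (b₂ a))
  -- norm transfer for each of them
  have t₁ := tiltExp_muD_le_gaussAvg H hβ hD ht hU hUD (fun a => sq_nonneg (G₁ a - a₁)) (integrable_bdd_mul_gaussWeight H hβ m₁ b₁)
  have t₂ := tiltExp_muD_le_gaussAvg H hβ hD ht hU hUD (fun a => sq_nonneg (G₂ a - a₂)) (integrable_bdd_mul_gaussWeight H hβ m₂ b₂)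
  have tU := tiltExp_muD_le_gaussAvg H hβ hD ht hU hUD (fun a => sq_nonneg (U a - b)) (integrable_bdd_mul_gaussWeight H hβ mU bU)
  have tp₁ := tiltExp_muD_le_gaussAvg H hβ hD ht hU hUD (fun a => mul_nonneg (sq_nonneg (G₁ a - a₁)) (sq_nonneg (U a - b)))
    (integrable_bdd_mul_gaussWeight H hβ (m₁.mul mU) bp₁)
  have tp₂ := tiltExp_muD_le_gaussAvg H hβ hD ht hU hUD (fun a => mul_nonneg (sq_nonneg (G₂ a - a₂)) (sq_nonneg (U a - b)))
    (integrable_bdd_mul_gaussWeight H hβ (m₂.mul mU) bp₂)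
  exact abs_tiltCum4_le_of_moments hU h₁ h₂ hUb h₁b h₂b t a₁ a₂ b t₁ t₂ tU tp₁ tp₂


end Tilt

end Summit.QuantumFields.YangMills.Theorems.AllWindowsColdBoxBoxHighLine

end
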